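import Literature.IUT.HodgeTheaters.PiAvatarLocalArrowLawL1OfTorsionMonodromy
import Literature.IUT.HodgeTheaters.PiAvatarLocalLabels
import HarnessLib

/-!
# [IUTchI] Def 6.1 (ii)(iii) at a BAD place: the local arrow law at the DECOMPOSITION STAND-IN `Π_{X̲_K} ∩ augGF⁻¹ G_v̲` —
# (L1) transfers, (L2) `sign` is REFUTED (proof-only; a statement about OUR profinite stand-in, not about print)

S. Mochizuki, *Inter-universal Teichmüller theory I*, kurims manuscript (May 2020), Def 3.1 (e) p. 63 («If `v̲ ∈ V̲^bad`, then …
`Π_v̲ := Π^tp_{X̲̳_v̲}`»), Def 6.1 (ii)(iii) pp. 156–157 [cite: Mochizuki2012, Def 3.1(e) p.63; Def 6.1(ii)(iii) pp.156-157]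
(D-0012 claim key; series DISPUTED — nothing of the series is asserted; no side is taken on [IUTchIII] Cor. 3.12).

WHAT (abc-iut-L5-lead gen 6 RULINGS #67 (1) «GO (N1)»; flip ledger #66 (b3) «BadPairAt-NV»; GAP-LEDGER G-L5t4g4-1 bad
place-class).  At a bad place the genuine local group is the tempered `Π^tp_{X̲̳_v̲}` ([EtTh]-side, after-merge); the tree's
candidate PROFINITE STAND-IN for the pair binder `BadPairAt v` (abc-iut-L5-t4, `PiAvatarPlaceData` p445979) was the
decomposition pair `H₀ := Π_{X̲_K} ∩ augGF⁻¹ G_v̲ ≤ Π_{C̲_K} ∩ augGF⁻¹ G_v̲`.  This file settles what abc-iut-L5-t4's interface law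
`LocalArrowLaw CG hS H₀` (p440701) does there, for EVERY subgroup `G_v̲ ≤ G_F`:
* (A) `localArrowLaw_L1_decompStandIn` — the (L1) field TRANSFERS (`embK(jKer) ≤ Π_{X̲→_K} ≤ H₀`; abc-iut-L5-d5's
  `localArrowLaw_L1_of_torsionMonodromy`, p445209, modulo `{M : TorsionMonodromy, hA, hI}`);
* (B) **`not_localArrowLaw_sign_decompStandIn` / `not_localArrowLaw_decompStandIn` — the (L2) field `sign` is FALSE at `H₀`,
  hence `¬ D.LocalArrowLaw CG hS H₀`**, from the typed data ALONE (t1's `CuspGalois`, t2's `ThetaGeometry`): a GEOMETRIC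
  element `g ∈ Δ_{X_K} ∖ Δ_{X̲_K}` (`exists_geom_act_ε0_eq_ε1`: `CG.gen` corrected along `ThetaGeometry.aug_PiXbar`) has
  `n := embK g` over `1 ∈ G_v̲`, normalising `Π_{X̲_K}` (`CuspGalois.normal_PiXbar`) and `augGF⁻¹ G_v̲`, so `n ∈ N(H₀)`; but
  `actF ⟨n, _⟩ = CG.act g` (`actF_embK`) moves `ε⁰ ↦ ε′`, i.e. reads `0 ↦ 1` in the chart based at `ε⁰`, which no `z ↦ ε z`
  does.  CONSEQUENCE for the (b3) NV: a kit built over `B v := ⟨H₀, …⟩` TOGETHER WITH a binder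
  `ΛBad : LocalArrowLaw CG hS (B v).H` is VACUOUS; the consistent profinite stand-in is the `(1, l-tors→)`-TYPE pair
  `⟨Π_{X̲→_K} ∩ augGF⁻¹ G_v̲, Π_{C̲→_K} ∩ augGF⁻¹ G_v̲⟩`, at whose `H` the law is abc-iut-L5-d5's THEOREM
  `localArrowLaw_local_of_torsionMonodromy CG hS M hA hI (D.decompAt v)` (p446888; `G_v̲` arbitrary there).
Proof-only (0 definitions, no instance, no notation); axioms standard.  HONEST FRAMING: (B) refutes a BINDER INSTANCE at OUR
stand-in — it says nothing against print, whose `Π_v̲` at bad `v̲` is the tempered `Π^tp_{X̲̳_v̲}`; typed ≠ inhabited ≠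
discharged; nothing here bears on [IUTchIII] Cor. 3.12.
-/

noncomputable section

namespace Literature.IUT.HodgeTheaters

open scoped Pointwise

universe u v w

variable {F : Type u} {K : Type v} {Fbar : Type w} [Field F] [NumberField F] [Field K] [NumberField K]
  [Algebra F K] [Field Fbar] [Algebra F Fbar] [Algebra K Fbar]
  {E : WeierstrassCurve F} [E.IsElliptic] {l : ℕ} {Pb : BadPlacePredicates K}

namespace InitialThetaData

variable (D : InitialThetaData F K Fbar E l Pb) (CG : D.geom.pe.CuspGalois) (hS : D.CuspClassesNormaliserStable)

/-! ### A geometric generator of `Gal(X̲_K/X_K)` -/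

/-- **A GEOMETRIC element of `Π_{X_K} ∖ Π_{X̲_K}` moving `ε⁰` to `ε′`**: `CG.gen` (with `gen·ε⁰ = ε′`) corrected by an
element of `Π_X̲` with the same Galois image («`X̲_K → X_K` is geometric», t2's `ThetaGeometry.aug_PiXbar`); elements of `Π_X̲`
act trivially on the cusps. ([IUTchI] Def 3.1 (d) p.62) [claim: Mochizuki2012, status: disputed] -/
theorem exists_geom_act_ε0_eq_ε1 :
    ∃ g ∈ D.geom.pe.PiX, g ∈ D.geom.pe.DeltaC ∧ CG.act g D.geom.pe.ε0 = D.geom.pe.ε1 := by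
  obtain ⟨⟨h, hh⟩, hhaug⟩ := D.geom.aug_PiXbar (D.geom.pe.E.aug CG.gen)
  refine ⟨CG.gen * h⁻¹, mul_mem CG.gen_mem (inv_mem hh.1), ?_, ?_⟩
  · change D.geom.pe.E.aug (CG.gen * h⁻¹) = 1
    have hha : D.geom.pe.E.aug h = D.geom.pe.E.aug CG.gen := hhaug
    rw [map_mul, map_inv, hha, mul_inv_cancel]
  · rw [map_mul, Equiv.Perm.mul_apply, CG.act_eq_one_of_mem_PiXbar (inv_mem hh), Equiv.Perm.one_apply,
      CG.act_gen_ε0]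

/-- For a geometric `g ∈ Π_{X_K}` (over `1 ∈ G_K`), `embK g` lies over `1 ∈ G_F`. ([IUTchI] Def 3.1 (d) p.62) [claim: Mochizuki2012, status: disputed] -/
theorem augGF_embK_eq_one_of_mem_DeltaC {g : D.geom.pe.PiC} (hg : g ∈ D.geom.pe.DeltaC) : D.augGF (D.geom.embK g) = 1 := by
  have h1 : D.geom.pe.E.aug g = 1 := hg
  have h2 := D.geom.aug_compat g
  rw [h1, map_one, Subgroup.coe_one] at h2
  exact h2

include CG in
/-- A geometric `embK g` (over `1 ∈ G_F`) normalises the DECOMPOSITION STAND-IN `Π_{X̲_K} ∩ augGF⁻¹ G_v̲` for every `G_v̲`.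
([IUTchI] Def 3.1 (e) p.63) [claim: Mochizuki2012, status: disputed] -/
theorem embK_mem_normalizer_decompStandIn {g : D.geom.pe.PiC} (hg : g ∈ D.geom.pe.DeltaC) (Gv : Subgroup (Fbar ≃ₐ[F] Fbar)) :
    D.geom.embK g ∈ Subgroup.normalizer (((D.PiXund ⊓ Gv.comap D.augGF : Subgroup D.PiC)) : Set D.PiC) := by
  have hN := D.embK_mem_normalizer_PiXund CG g
  rw [Subgroup.mem_normalizer_iff] at hN ⊢
  intro y
  have h1 : D.augGF (D.geom.embK g) = 1 := D.augGF_embK_eq_one_of_mem_DeltaC hg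
  rw [Subgroup.mem_inf, Subgroup.mem_inf, Subgroup.mem_comap, Subgroup.mem_comap, map_mul, map_mul, map_inv, h1, one_mul,
    inv_one, mul_one, hN y]

variable [Fact l.Prime]

/-! ### (B) The (L2) field `sign` FAILS at the decomposition stand-in -/

/-- **(B) At the decomposition stand-in `H₀ = Π_{X̲_K} ∩ augGF⁻¹ G_v̲` the (L2) field `sign` of `LocalArrowLaw` is FALSE** (every
`G_v̲ ≤ G_F`): the geometric `n = embK g`, `g ∈ Δ_{X_K} ∖ Δ_{X̲_K}`, normalises `H₀` and `Π_{X̲_K}` but acts on the cusps as the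
deck translation `ε⁰ ↦ ε′`, i.e. `0 ↦ 1` in the chart based at `ε⁰` — not of the form `z ↦ ε z`.
([IUTchI] Def 6.1(iii) p.157) [claim: Mochizuki2012, status: disputed] -/
theorem not_localArrowLaw_sign_decompStandIn (Gv : Subgroup (Fbar ≃ₐ[F] Fbar)) :
    ¬ (∀ n : D.PiC, n ∈ Subgroup.normalizer (((D.PiXund ⊓ Gv.comap D.augGF : Subgroup D.PiC)) : Set D.PiC) →
        ∀ hn : n ∈ Subgroup.normalizer ((D.PiXund : Subgroup D.PiC) : Set D.PiC),
          ∃ ε : ℤˣ, ∀ x, D.gChart₀Model CG (D.actF CG hS ⟨n, hn⟩ x) = ε • D.gChart₀Model CG x) := by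
  intro hsign
  obtain ⟨g, _, hgΔ, hact⟩ := D.exists_geom_act_ε0_eq_ε1 CG
  have hn := D.embK_mem_normalizer_PiXund CG g
  obtain ⟨ε, hε⟩ := hsign (D.geom.embK g) (D.embK_mem_normalizer_decompStandIn CG hgΔ Gv) hn
  have h := hε D.geom.pe.ε0
  rw [D.actF_embK CG hS g hn, hact, D.gChart₀Model_ε1 CG, D.gChart₀Model_ε0 CG, smul_zero] at h
  exact one_ne_zero h

/-- **The interface law `LocalArrowLaw` is UNINHABITABLE at the decomposition stand-in** `Π_{X̲_K} ∩ augGF⁻¹ G_v̲` (every `G_v̲`):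
a binder `Λ : D.LocalArrowLaw CG hS (D.PiXund ⊓ Gv.comap D.augGF)` is VACUOUS.  (Its genuine home at a bad place is the tempered
`Π^tp_{X̲̳_v̲}`; the consistent profinite stand-in is `Π_{X̲→_K} ∩ augGF⁻¹ G_v̲`, where the law is the theorem
`localArrowLaw_local_of_torsionMonodromy`, p446888.) ([IUTchI] Def 6.1(iii) p.157) [claim: Mochizuki2012, status: disputed] -/
theorem not_localArrowLaw_decompStandIn (Gv : Subgroup (Fbar ≃ₐ[F] Fbar)) :
    ¬ D.LocalArrowLaw CG hS (D.PiXund ⊓ Gv.comap D.augGF) :=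
  fun Λ => D.not_localArrowLaw_sign_decompStandIn CG hS Gv Λ.sign

/-- The same for `IsEmpty`-style consumers: no `LocalArrowLaw` at the decomposition stand-in, as a universally quantified negation.
([IUTchI] Def 6.1(iii) p.157) [claim: Mochizuki2012, status: disputed] -/
theorem localArrowLaw_decompStandIn_elim (Gv : Subgroup (Fbar ≃ₐ[F] Fbar)) {P : Prop}
    (Λ : D.LocalArrowLaw CG hS (D.PiXund ⊓ Gv.comap D.augGF)) : P :=
  (D.not_localArrowLaw_decompStandIn CG hS Gv Λ).elim

/-! ### (A) The (L1) field TRANSFERS to the decomposition stand-in -/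

omit [Fact l.Prime] in
/-- **(A) (L1) at the decomposition stand-in** (every `G_v̲`): an element `d` with `d⁻¹ (Π_{X̲_K} ∩ augGF⁻¹ G_v̲) d ≤ Π_{X̲_K}`
normalises `Π_{X̲_K}` — abc-iut-L5-d5's `TorsionMonodromy.localArrowLaw_L1_of_torsionMonodromy` (p445209) with
`embK(jKer) ≤ Π_{X̲→_K} ∩ augGF⁻¹ G_v̲ ≤ Π_{X̲_K} ∩ augGF⁻¹ G_v̲`. ([IUTchI] Ex 6.3(i) p.161) [claim: Mochizuki2012, status: disputed] -/
theorem localArrowLaw_L1_decompStandIn (M : D.TorsionMonodromy) (hA : D.geom.pe.ArrowCoveringClaims)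
    (hI : ∀ k ∈ D.geom.pe.inertia D.geom.pe.ε1, M.tau (D.geom.embK k) = 0) (Gv : Subgroup (Fbar ≃ₐ[F] Fbar)) :
    ∀ d : D.PiC, (∀ x ∈ D.PiXund ⊓ Gv.comap D.augGF, d⁻¹ * x * d ∈ D.PiXund) →
      d ∈ Subgroup.normalizer ((D.PiXund : Subgroup D.PiC) : Set D.PiC) :=
  M.localArrowLaw_L1_of_torsionMonodromy hA hI
    (le_trans (TorsionMonodromy.map_jKer_le_local hA Gv) (inf_le_inf_right _ D.PiXarrow_le_PiXund))

end InitialThetaData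

end Literature.IUT.HodgeTheaters

end
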